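import Summits.ABC.ABC.Theorems.SolvedZooL3Unconditional
import Summits.ABC.ABC.Theorems.SolvedZooL2QuarticBridge

/-!
# `SolvedZooABC` ⇐ its four LEAVES, by name (F1 replaced by Chen–Voutier's simplest quartic Thue theorem)

Census handle for the crux `Summit.ABC.ABC.Theses.ThreeSlotCyclotomicDescent.SolvedZooABC`
(stmt-ABC-24025, route `ThreeSlotCyclotomicDescent`). The assembly of record
`SolvedZooL3Unconditional.solvedZooABC_of_facts4` (★ p615669) derives the crux from the four named facts
F1 = [Ljunggren1942] `ljunggren1942_sqPlusOneEqTwiceFourth`, F3 = [Le2002] `le2002_sqPlusPow2EqPow`,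
[DarmonMerel1997] Main Theorem (2) `darmonMerel1997_sumOfPowersEqSquare` and (3)
`darmonMerel1997_sumOfPowersEqCube`; and `SolvedZooL2QuarticBridge` (★ p610666) derives F1 from the deep leaf
`SimplestQuarticThueSolutions` ([ChenVoutier1997, Thm 3] = [LettlPetho1995], used at `t = 4` only, via the
four-cell wall's `UniformSadicTowerFour.QuarticRootWall.ljunggren_of_simplestQuarticThue`). This file
composes the two, so that the census sentence of record

  «24025 = PROVED-MOD-FACTS {`SimplestQuarticThueSolutions`, `le2002_sqPlusPow2EqPow`,
   `darmonMerel1997_sumOfPowersEqSquare`, `darmonMerel1997_sumOfPowersEqCube`}, n = 4 named, 0 raw binders»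

is ONE kernel-checked declaration (`solvedZooABC_of_leaves`), together with the per-family handle
`solvedZoo_L2_of_simplestQuarticThue` (family (ii) ∨ swap, `C = 10`, modulo the Chen–Voutier leaf alone —
the odd-exponent half is the THEOREM `cohn1996_lemma_odd`, ★ p609304).

PROOF-ONLY file (no definitions, no named facts, no `sorry`); serves stmt-ABC-24025
`--supports … --as helper` WITHOUT closing it: a kernel-checked IMPLICATION from four unproved published
theorems. HONESTY (INPUTS→UNCONDITIONAL, D-0154 (2)): bookkeeping at abc distance 0; abc moved by 0;
NOT abc; typed ≠ proved; PROVED-MOD-FACTS ≠ proved.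
-/

-- `Summit.<Summit>.<Problem>` is the mandated summit-side namespace (CONVENTIONS §2); for the
-- single-conjunct summit `ABC` the two coincide, so the duplicate `ABC.ABC` is deliberate.
set_option linter.dupNamespace false

namespace Summit.ABC.ABC.Theorems.SolvedZooAssemblyOfLeaves

open Literature.NumberTheory.DiophantineGeometry
open Summit.ABC.ABC.Theses.ThreeSlotCyclotomicDescent
open Summit.ABC.ABC.Theorems

/-- **Family (ii) of the solved zoo (`1 + p^{2u} = 2·r^z`, `z ≥ 4` even, and its swap) in abc(ε) form with
`C = 10`, MODULO the Chen–Voutier leaf alone.** The consumer `SolvedZooL2Consumer.solvedZoo_L2_of` takes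
the odd-exponent half `hOdd` — discharged by the THEOREM `cohn1996_lemma_odd` (★ p609304) — and the quartic
half `hQuartic : ∀ x t, x² + 1 = 2t⁴ → t ∈ {1, 13}` — discharged from `SimplestQuarticThueSolutions` by
`quartic_root_eq_of_simplestQuarticThue` (★ p610666). [cite: ChenVoutier1997, Thm 3] -/
theorem solvedZoo_L2_of_simplestQuarticThue (hCV : SimplestQuarticThueSolutions) :
    ∀ ε : ℝ, 0 < ε → ∃ C : ℝ, 0 < C ∧ ∀ a b c : ℕ, IsABCTriple a b c →
      ((∃ u p r z : ℕ, p.Prime ∧ r.Prime ∧ 1 ≤ u ∧ 4 ≤ z ∧ Even z ∧ a = 1 ∧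
          b = p ^ (2 * u) ∧ c = 2 * r ^ z) ∨
       (∃ u p r z : ℕ, p.Prime ∧ r.Prime ∧ 1 ≤ u ∧ 4 ≤ z ∧ Even z ∧ b = 1 ∧
          a = p ^ (2 * u) ∧ c = 2 * r ^ z)) →
      (c : ℝ) < C * ((rad a b c : ℕ) : ℝ) ^ (1 + ε) :=
  SolvedZooL2Consumer.solvedZoo_L2_of cohn1996_lemma_odd (quartic_root_eq_of_simplestQuarticThue hCV)

/-- **`SolvedZooABC` (stmt-ABC-24025) ⇐ its four LEAVES, BY NAME:** [ChenVoutier1997, Thm 3]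
`SimplestQuarticThueSolutions` (⇒ F1 [Ljunggren1942] by `ljunggren1942_sqPlusOneEqTwiceFourth_of_simplestQuarticThue`,
★ p610666; closes family (ii) together with the theorem `cohn1996_lemma_odd`), [Le2002]
`le2002_sqPlusPow2EqPow` (family (i)), [DarmonMerel1997, Main Theorem (2), (3)] (family (iv)); family (iii)
is unconditional (`SolvedZooL3Unconditional.solvedZoo_L3_unconditional`, ★ p615669). Kernel-checked
IMPLICATION only — 24025 is NOT closed by this (facts remaining n = 4, all named, 0 raw binders);
PROVED-MOD-FACTS ≠ proved; not abc, abc moved by 0. [folklore] -/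
theorem solvedZooABC_of_leaves (hCV : SimplestQuarticThueSolutions) (hF3 : le2002_sqPlusPow2EqPow)
    (h₂ : darmonMerel1997_sumOfPowersEqSquare) (h₃ : darmonMerel1997_sumOfPowersEqCube) :
    SolvedZooABC :=
  SolvedZooL3Unconditional.solvedZooABC_of_facts4
    (ljunggren1942_sqPlusOneEqTwiceFourth_of_simplestQuarticThue hCV) hF3 h₂ h₃

end Summit.ABC.ABC.Theorems.SolvedZooAssemblyOfLeaves
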